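import Summits.Ventures.QEC.CircuitDistance.PortK2Check
import HarnessLib

/-!
# K2 chunking glue for the checker of record `K2.K2Data.dfs` (idea-1 g2, CARD-5S re-targeted per ARBITRATION 19:51:47Z (3))

Close a DFS state by closing its CHILDREN one level down: `K2Data.children` collects exactly the states `goList` hands to
the recursive call, in order; `dfs_succ_of_children` is one unfolding step of the `dfs` recursion; `cube_of_children` the
same at the cube root.  A cube fact `D.cube T p live = true` is then ASSEMBLED from per-child facts
`app5 (D.dfs T r) s = true` (each closed by `decide` / `native_decide` in its own small theorem), the children list being
re-derived by the kernel (`D.cubeChildren p live = kids` by `decide`), all budgets passed as literals — so the kernel never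
unfolds `dfs` symbolically (see CARD-5S §3: any defeq `app5 (dfs …) s =?= dfs …` makes it do so and run out of memory).
Nothing about `dfs` / `cube` / `dfs_sound` changes; every per-cube end statement is still literally `D.cube T p live = true`.
-/

namespace Summit.Ventures.QEC.CircuitDistance.K2

/-- The child states `(U', L', Wm', card', live')` that `goList` hands to `k`, in the same order. -/
def K2Data.children (D : K2Data) (U L Wm card : ℕ) : List ℕ → ℕ → List (ℕ × ℕ × ℕ × ℕ × ℕ)
  | [], _ => []
  | h :: hs, live =>
    if live.testBit h then
      (U ^^^ D.synOf h, L ^^^ D.lgOf h, Wm ||| 2 ^ h, card + 1, live ^^^ 2 ^ h) ::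
        D.children U L Wm card hs (live ^^^ 2 ^ h)
    else D.children U L Wm card hs live

/-- Apply a 5-ary state function to a packed state `(U, L, Wm, card, live)`. -/
def app5 (k : ℕ → ℕ → ℕ → ℕ → ℕ → Bool) (s : ℕ × ℕ × ℕ × ℕ × ℕ) : Bool :=
  k s.1 s.2.1 s.2.2.1 s.2.2.2.1 s.2.2.2.2

/-- K2 chunking glue (`app5_mk`): see the module docstring (idea-1 CARD-5S). -/
theorem app5_mk (k : ℕ → ℕ → ℕ → ℕ → ℕ → Bool) (U L Wm card live : ℕ) :
    app5 k (U, L, Wm, card, live) = k U L Wm card live := rfl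

/-- The loop succeeds if every child it would call succeeds. -/
theorem K2Data.goList_of_children (D : K2Data) (k : ℕ → ℕ → ℕ → ℕ → ℕ → Bool) (U L Wm card : ℕ) :
    ∀ (l : List ℕ) (live : ℕ), (∀ s ∈ D.children U L Wm card l live, app5 k s = true) →
      D.goList k U L Wm card l live = true := by
  intro l
  induction l with
  | nil => intro live _; rfl
  | cons h hs ih =>
    intro live hall
    unfold K2Data.goList
    unfold K2Data.children at hall
    by_cases ht : live.testBit h = true
    · rw [if_pos ht] at hall ⊢
      rw [Bool.and_eq_true]
      refine ⟨?_, ih _ fun s hs' => hall s (List.mem_cons_of_mem _ hs')⟩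
      have := hall _ List.mem_cons_self
      rw [app5_mk] at this
      exact this
    · rw [if_neg ht] at hall ⊢
      exact ih _ hall

/-- The children of a DFS state at budget `r + 1` (empty if the state is a stop or is pruned). -/
def K2Data.stateChildren (D : K2Data) (r U L Wm card live : ℕ) : List (ℕ × ℕ × ℕ × ℕ × ℕ) :=
  if U = 0 then [] else if D.M * (r + 1) < popBelow U D.C then [] else
    D.children U L Wm card (D.candOf (firstBit U D.C)) live

/-- GLUE: a non-stop state at budget `r + 1` is closed by closing each of its children at budget `r`. -/
theorem K2Data.dfs_succ_of_children (D : K2Data) (T : List ℕ) (r U L Wm card live : ℕ) (hU : U ≠ 0)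
    (h : ∀ s ∈ D.stateChildren r U L Wm card live, app5 (D.dfs T r) s = true) :
    D.dfs T (r + 1) U L Wm card live = true := by
  unfold K2Data.dfs
  rw [if_neg hU]
  by_cases hp : D.M * (r + 1) < popBelow U D.C
  · rw [if_pos hp]
  · rw [if_neg hp]
    apply D.goList_of_children
    intro s hs
    apply h
    unfold K2Data.stateChildren
    rw [if_neg hU, if_neg hp]
    exact hs

/-- The cube as a root state. -/
theorem K2Data.cube_eq (D : K2Data) (T : List ℕ) (p live : ℕ) :
    D.cube T p live = D.dfs T (D.w - 1) (D.synOf p) (D.lgOf p) (2 ^ p) 1 live := rfl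

/-- The depth-1 chunks of a cube (children of its root state, at budget `w - 2`). -/
def K2Data.cubeChildren (D : K2Data) (p live : ℕ) : List (ℕ × ℕ × ℕ × ℕ × ℕ) :=
  D.stateChildren (D.w - 2) (D.synOf p) (D.lgOf p) (2 ^ p) 1 live

/-- Cons step for assembling `kids.all f = true` from per-chunk facts without any definitional unfolding of `f`. -/
theorem all_cons_of {α : Type} {f : α → Bool} {a : α} {l : List α}
    (h₁ : f a = true) (h₂ : l.all f = true) : (a :: l).all f = true := by
  rw [List.all_cons, h₁, h₂]; rfl

/-- K2 chunking glue (`all_nil_of`): see the module docstring (idea-1 CARD-5S). -/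
theorem all_nil_of {α : Type} (f : α → Bool) : ([] : List α).all f = true := rfl

/-- GLUE at the root: a cube is closed by closing its depth-1 chunks at budget `r = w - 2`.
Usage (everything by closed computation):
`K2Data.cube_of_children D T p live r [s₀, …, sₖ] (by decide) (by decide) (by decide) (by decide)
   (all_cons_of ch₀ (all_cons_of ch₁ (… (all_nil_of _))))`
where `chᵢ : app5 (D.dfs T r) sᵢ = true` is its own theorem proved by `decide` / `native_decide`. -/
theorem K2Data.cube_of_children (D : K2Data) (T : List ℕ) (p live r : ℕ) (kids : List (ℕ × ℕ × ℕ × ℕ × ℕ))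
    (hk : D.cubeChildren p live = kids) (hw : D.w - 1 = r + 1) (hr : D.w - 2 = r) (hU : D.synOf p ≠ 0)
    (h : kids.all (app5 (D.dfs T r)) = true) :
    D.cube T p live = true := by
  subst hk; subst hr
  rw [K2Data.cube_eq, hw]
  exact D.dfs_succ_of_children T _ _ _ _ _ _ hU (List.all_eq_true.mp h)

/-- GLUE one level further down (depth-2 chunks, or deeper): same shape for an arbitrary non-stop state; the budget is
passed as literals `r' = r + 1` so that no arithmetic is left to definitional unfolding. -/
theorem K2Data.dfs_succ_of_children' (D : K2Data) (T : List ℕ) (r r' U L Wm card live : ℕ)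
    (kids : List (ℕ × ℕ × ℕ × ℕ × ℕ)) (hk : D.stateChildren r U L Wm card live = kids)
    (hr : r' = r + 1) (hU : U ≠ 0)
    (h : kids.all (app5 (D.dfs T r)) = true) :
    app5 (D.dfs T r') (U, L, Wm, card, live) = true := by
  subst hk; subst hr
  exact D.dfs_succ_of_children T r U L Wm card live hU (List.all_eq_true.mp h)

end Summit.Ventures.QEC.CircuitDistance.K2
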